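import Literature.MathematicalPhysics.QuantumFieldTheory.Balaban1983to89.B4CubeGreenBox
import Literature.MathematicalPhysics.QuantumFieldTheory.Balaban1983to89.B4WalkRouteRegion
import Literature.MathematicalPhysics.QuantumFieldTheory.Balaban1983to89.B4CubeFields22
import Literature.MathematicalPhysics.QuantumFieldTheory.Balaban1983to89.B4Eq220PartitionSizes

/-!
# `Balaban1983to89.B4RegionCubeCarrier` — [Balaban1983RegularityDecay] §2 p. 575: THE CUBES `□_j = Ω ∩ {2M-cube at Mj}`
# OF A GENERAL REGION `Ω` (a finite union of big blocks) AS SUB-CARRIERS OF THE FINE REGION `fineDom n Ωc` — the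
# sub-region inclusion (every cube, «if □_j intersects the boundary ∂Ω, then we take Ã_j = A») and the translated box
# (interior cubes, «□_j is a cube of the size 2M and with center in Mj», where Lemma 2.2 lives), with the data
# identities: [B4]'s bond weights, block weights, base corners, staircase contours, transporters and the cube
# configurations `Ã_j` restrict along both embeddings to the sub-carrier's OWN data

statement-level skeleton of published theorems with citation tags; proofs where landed; nothing here is a claim about the Yang–Mills mass gap

CITATION HEADER.  T. Bałaban, *Regularity and decay of lattice Green's functions*, Commun. Math. Phys. **89** (1983)
571–597, doi:10.1007/bf01214744 [Balaban1983RegularityDecay] (cell paper B4; held text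
`paper:balaban1983-cmp89-regularity-decay`, journal page = PDF page + 570; pp. 572–573, 575–579).  Unit `lit-balaban-r01`
gen 7 (B4 fold owner), HOME `run/shared/lean/pub/lit-balaban/`, SKELETON rows **B4.Def§2** (the cubes `□_j`, the
configurations `Ã_j`), **B4.Eq2.2**, **B4.Thm@573** (file 2 of the r01 g7 programme: THEOREM (1.10) value member for a
GENERAL `Ω` under `R₀`, end to end).  Imports `B4CubeGreenBox` (→ p17 g4's `B4SubBoxCarrier`: `mem_nbrs_add_iff`,
`lsum_map`, `map_val_stairContour`; → `B4CubeOpReindex`), `B4WalkRouteRegion` (r01 g6: `rpos`, `labels`, the region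
carriers of `B4Lower18RegularRegion`: `regWt`, `rBlkWt`, `rbaseEmb`, `rstairContour`, `compField`), p35 g6's
`B4CubeFields22` (`cubeField`, `thetaZ`) and `B4Eq220PartitionSizes` (`hZ`, `hBox`).

WHAT IS PRINTED (p. 575, verbatim).  «We have assumed that Ω^{(k)} is a sum of large blocks, i.e. blocks of the size M on
the unit lattice, thus Ω is a sum of the corresponding large blocks of the size M on η-lattice T_η. For each j ∈ Z^d, let
us define the set □_j = Ω ∩ {a sum of large blocks for which the point Mj is one of the vertices}. Let us observe that if
the point Mj is not a boundary point of Ω, then □_j is a cube of the size 2M and with center in Mj. For Mj lying on the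
boundary the set □_j is a sum of several (≦ 2^d) large blocks. … if □_j intersects the boundary of Ω, then A_j = A; if
□_j is an interior cube of Ω, then we take A_j as equal to A on the cube {x: |x − Mj| ≦ ¾M}, and changing regularly to a
constant function in a neighborhood of a boundary of □_j … Ã_j = A₀ + θ_jA′.»

WHAT THIS MODULE PROVES (all in full; `d + 1` lattice dimensions; fine region `fineDom n Ωc` = the unit blocks with labels
in the finite set `Ωc ⊂ ℤ^{d+1}`, mesh `η = 1/n`; large-cube size `K` unit blocks, so `M = nK` fine units).
* §1 THE CUBE GEOMETRY: `cubeLabels K j` (the unit labels `y` with `K(j_μ − 1) ≤ y_μ < K(j_μ + 1)`: the `2K`-cube at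
  `Kj`), `cshift K j = K(j − 1)` (its lower corner), `inBox n o Ms` (the block-compatible site set «blocks with label in
  `o + [0, Ms)`», decidable), `inBox_of_near` (the `(7/8)M`-box around `Mj` lies in the cube: hypothesis `hS` of
  `B4Ineq110LpChain.ineq110_value_lp`), `inBox_iff_of_rBlkWt` (unit blocks do not straddle).
* §2 THE SUB-REGION INCLUSION `incl : fineDom n Ωc′ ↪ fineDom n Ωc` (`Ωc′ ⊆ Ωc`), `inclY`, image `inReg`
  (`blk n x ∈ Ωc′`), DATA IDENTITIES `regWt_incl`, `rBlkWt_incl`, `rbaseEmb_inclY`, `rstairContour_incl`,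
  `contourTrans_incl`, `rBlkWt_incl_ne_zero`.
* §3 THE TRANSLATED BOX `boxEmb : Box d ℓ k Ms ↪ fineDom n Ωc`, `z ↦ z + n·o` (`n = L^k`; every label of `o + [0,Ms)` in
  `Ωc`), `boxEmbY` (`y ↦ y + o`), image `inBox` (`inBox_iff`), DATA IDENTITIES `regWt_boxEmb` (= `boxWt`),
  `rBlkWt_boxEmb` (= `blkWt`), `rbaseEmb_boxEmbY`, `rstairContour_boxEmb` (= the lineage's `stairContour`, translated:
  `B4Prop31Holonomy.stair_add`), `contourTrans_boxEmb`, `rBlkWt_boxEmb_ne_zero`.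
* §4 FIELDS AND PARTITION FUNCTIONS ALONG THE TRANSLATION: `compField_add` (a component field translates),
  `constBond_boxEmb`, `thetaZ_add`/`hZ_add` (`θ_j(x + nK(j − j′)) = θ_{j′}(x)`), **`cubeField_boxEmb`** (p35's
  `Ã_j = A₀ + θ_jA′` on the region, restricted along `boxEmb` with `o = K(j − j′)`, IS the cube configuration `Ã_{j′}`
  of the translated component field on the box), `hCube_rpos_eq_hZ` (the walk route's `h_j` at `M = nK` is [B4]'s `hZ`),
  `hZ_boxEmb`/`hBox` (its restriction is `hBox`).
HONEST SCOPE.  Pure lattice bookkeeping, no analytic bound; the cube operators, `hGj`, letters and inputs are the sequel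
(`B4CubeGreenRegion`, `B4Thm110RegionLp`).  `def`s with bodies (`cubeLabels`, `cshift`, `inBox`, `incl`, `inclY`,
`inReg`, `boxEmb`, `boxEmbY`), two decidability instances, no `Prop`-valued fact, no `sorry`; axioms standard.
-/

namespace Literature.MathematicalPhysics.QuantumFieldTheory.Balaban1983to89.B4RegionCubeCarrier

open Literature.MathematicalPhysics.QuantumFieldTheory.Balaban1983to89.B4Reflection242 (boxDom mem_boxDom nbrs mem_nbrs
  blk blk_mem_boxDom blk_mul)
open Literature.MathematicalPhysics.QuantumFieldTheory.Balaban1983to89.B4GaugeCovariance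
open Literature.MathematicalPhysics.QuantumFieldTheory.Balaban1983to89.B4Commutators25to211 (mulH opK)
open Literature.MathematicalPhysics.QuantumFieldTheory.Balaban1983to89.B4Lower18 (fineDom mem_fineDom)
open Literature.MathematicalPhysics.QuantumFieldTheory.Balaban1983to89.B4Lower18Regular (e1 stair lsum baseEmb
  stairContour transport_fieldLink blkWt_ne_zero)
open Literature.MathematicalPhysics.QuantumFieldTheory.Balaban1983to89.B4Lower18RegularRegion (regWt rBlkWt rbaseEmb
  rstairContour compField rBlkWt_ne_zero)
open Literature.MathematicalPhysics.QuantumFieldTheory.Balaban1983to89.B4Lemma22ReduceZero (Box)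
open Literature.MathematicalPhysics.QuantumFieldTheory.Balaban1983to89.B4Prop31Holonomy (stair_add)
open Literature.MathematicalPhysics.QuantumFieldTheory.Balaban1983to89.B4TwoBox120 (blk_add_mul)
open Literature.MathematicalPhysics.QuantumFieldTheory.Balaban1983to89.B4SubBoxCarrier (mem_nbrs_add_iff lsum_map
  map_val_stairContour)
open Literature.MathematicalPhysics.QuantumFieldTheory.Balaban1983to89.B4PartitionUnity22 (hCube thetaCube)
open Literature.MathematicalPhysics.QuantumFieldTheory.Balaban1983to89.B4Eq220PartitionSizes (hZ hBox)
open Literature.MathematicalPhysics.QuantumFieldTheory.Balaban1983to89.B4CubeFields22 (thetaZ fluct cubeFluct cubeField)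
open Literature.MathematicalPhysics.QuantumFieldTheory.Balaban1983to89.B4WalkRouteRegion (rpos)
open scoped Matrix

noncomputable section

variable {d : ℕ}

/-! ## §1. The cube geometry on the unit labels -/

section Geometry

/-- **THE UNIT LABELS OF THE CUBE `□̂_j`**: `y` with `K(j_μ − 1) ≤ y_μ < K(j_μ + 1)` — the `2K` large... unit blocks per
direction around the vertex `Kj` («□_j is a cube of the size 2M and with center in Mj»; `M = K` unit blocks).
[cite: Balaban1983RegularityDecay, §2 p.575] -/
def cubeLabels (K : ℕ) (j : Fin (d + 1) → ℤ) : Finset (Fin (d + 1) → ℤ) :=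
  Fintype.piFinset fun i => Finset.Ico ((K : ℤ) * (j i - 1)) ((K : ℤ) * (j i + 1))

/-- membership in the cube's label set. [cite: Balaban1983RegularityDecay, §2 p.575] -/
theorem mem_cubeLabels {K : ℕ} {j y : Fin (d + 1) → ℤ} :
    y ∈ cubeLabels K j ↔ ∀ i, (K : ℤ) * (j i - 1) ≤ y i ∧ y i < (K : ℤ) * (j i + 1) := by
  simp [cubeLabels, Fintype.mem_piFinset]

/-- the LOWER CORNER of the cube in unit labels: `K(j − 1)`. [cite: Balaban1983RegularityDecay, §2 p.575] -/
def cshift (K : ℕ) (j : Fin (d + 1) → ℤ) : Fin (d + 1) → ℤ := fun i => (K : ℤ) * (j i - 1)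

/-- the cube's labels are the translate `cshift K j + [0, 2K)^{d+1}`. [cite: Balaban1983RegularityDecay, §2 p.575] -/
theorem mem_cubeLabels_iff_shift {K : ℕ} {j y : Fin (d + 1) → ℤ} :
    y ∈ cubeLabels K j ↔ ∀ i, cshift K j i ≤ y i ∧ y i < cshift K j i + (2 * K : ℕ) := by
  rw [mem_cubeLabels]
  refine forall_congr' fun i => ?_
  simp only [cshift]
  push_cast
  constructor <;> rintro ⟨h1, h2⟩ <;> exact ⟨by linarith, by linarith⟩

variable {n : ℕ} {Ωc : Finset (Fin (d + 1) → ℤ)}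

/-- **THE BLOCK-COMPATIBLE SITE SET OF A TRANSLATED BOX**: the sites of the fine region whose unit block has label in
`o + [0, Ms)` (for the cube `□_j`: `o = K(j − 1)`, `Ms = 2K`). [cite: Balaban1983RegularityDecay, §2 p.575, (1.1) p.572] -/
def inBox (n : ℕ) (o : Fin (d + 1) → ℤ) (Ms : Fin (d + 1) → ℕ) (x : ↥(fineDom n Ωc)) : Prop :=
  ∀ i, o i ≤ blk n x.1 i ∧ blk n x.1 i < o i + Ms i

/-- membership in the site set is decidable (the cut weights `1[z ∈ □ ↔ z′ ∈ □]` of the walk route need it).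
[cite: Balaban1983RegularityDecay, §2 p.575, dictionary] -/
instance inBox.instDecidablePred (n : ℕ) (o : Fin (d + 1) → ℤ) (Ms : Fin (d + 1) → ℕ) :
    DecidablePred (inBox (Ωc := Ωc) n o Ms) := fun x => by
  unfold inBox; infer_instance

/-- the site set of the cube `□_j` is «blocks with label in `cubeLabels K j`». [cite: Balaban1983RegularityDecay, §2 p.575] -/
theorem inBox_cshift_iff {K : ℕ} {j : Fin (d + 1) → ℤ} (x : ↥(fineDom n Ωc)) :
    inBox n (cshift K j) (fun _ => 2 * K) x ↔ blk n x.1 ∈ cubeLabels K j := by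
  rw [mem_cubeLabels_iff_shift]
  rfl


/-- a label of `[0, 2K)^{d+1}` translated by the lower corner lies in the cube's label set.
[cite: Balaban1983RegularityDecay, §2 p.575] -/
theorem shift_mem_cubeLabels (K : ℕ) (j : Fin (d + 1) → ℤ) (y : ↥(boxDom fun _ : Fin (d + 1) => 2 * K)) :
    y.1 + cshift K j ∈ cubeLabels K j := by
  rw [mem_cubeLabels_iff_shift]
  intro i
  obtain ⟨h1, h2⟩ := (mem_boxDom.1 y.2) i
  simp only [Pi.add_apply]
  constructor <;> linarith

/-- **AN INTERIOR CUBE** («□_j contained in Ω»): if every label of the cube lies in `Ωc`, the translated box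
`cshift K j + [0, 2K)^{d+1}` does. [cite: Balaban1983RegularityDecay, §2 p.575, (2.19) p.578 «all □_{ω_i} are cubes contained in Ω»] -/
theorem shift_mem_of_cube_subset {K : ℕ} {j : Fin (d + 1) → ℤ} (h : cubeLabels K j ⊆ Ωc)
    (y : ↥(boxDom fun _ : Fin (d + 1) => 2 * K)) : y.1 + cshift K j ∈ Ωc :=
  h (shift_mem_cubeLabels K j y)

/-- an integer within `7n K/8` (as a real) of `nKj` has quotient by `n` in `[K(j−1), K(j+1))`. [folklore] -/
private theorem ediv_window {n K : ℕ} (hn : 1 ≤ n) (hK : 1 ≤ K) {z j : ℤ}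
    (h : |(z : ℝ) - ((n : ℝ) * K) * j| ≤ 7 / 8 * ((n : ℝ) * K)) :
    (K : ℤ) * (j - 1) ≤ z / (n : ℤ) ∧ z / (n : ℤ) < (K : ℤ) * (j + 1) := by
  have hn0 : (0 : ℤ) < n := by exact_mod_cast hn
  have hnr : (0 : ℝ) < n := by exact_mod_cast hn
  have hKr : (1 : ℝ) ≤ K := by exact_mod_cast hK
  obtain ⟨h1, h2⟩ := abs_le.mp h
  -- real bounds `nK(j-1) < z < nK(j+1)` pulled back to `ℤ`
  have hlo : ((n : ℤ) * (K * (j - 1)) : ℤ) ≤ z := by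
    have : ((n : ℝ) * (K * (j - 1))) ≤ z := by nlinarith
    exact_mod_cast this
  have hhi : z < (n : ℤ) * (K * (j + 1)) := by
    have : (z : ℝ) < (n : ℝ) * (K * (j + 1)) := by nlinarith
    exact_mod_cast this
  constructor
  · exact (Int.le_ediv_iff_mul_le hn0).mpr (by rw [mul_comm]; exact hlo)
  · exact (Int.ediv_lt_iff_lt_mul hn0).mpr (by rw [mul_comm]; exact hhi)

/-- **`hS`: THE `(7/8)M`-BOX AROUND `Mj` LIES IN THE CUBE's SITE SET** (`M = nK`): hypothesis `hS` of
`B4Ineq110LpChain.ineq110_value_lp` for `S_j = inBox n (cshift K j) 2K`. [cite: Balaban1983RegularityDecay, §2 p.575 «|x − Mj| ≤ ⅞M»] -/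
theorem inBox_of_near (hn : 1 ≤ n) {K : ℕ} (hK : 1 ≤ K) (j : Fin (d + 1) → ℤ) (z : ↥(fineDom n Ωc))
    (h : ∀ μ, |rpos n Ωc z μ - ((n : ℝ) * K) * j μ| ≤ 7 / 8 * ((n : ℝ) * K)) :
    inBox n (cshift K j) (fun _ => 2 * K) z := by
  intro i
  obtain ⟨h1, h2⟩ := ediv_window hn hK (h i)
  simp only [cshift, blk]
  push_cast
  constructor <;> linarith

/-- **UNIT BLOCKS DO NOT STRADDLE THE CUBE**: two sites of one averaging block are both in or both out of `S_j`.
[cite: Balaban1983RegularityDecay, (1.1) p.572, §2 p.575] -/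
theorem inBox_iff_of_rBlkWt (o : Fin (d + 1) → ℤ) (Ms : Fin (d + 1) → ℕ) {y : ↥Ωc} {z z' : ↥(fineDom n Ωc)}
    (hz : rBlkWt n Ωc (fineDom n Ωc) y z ≠ 0) (hz' : rBlkWt n Ωc (fineDom n Ωc) y z' ≠ 0) :
    inBox n o Ms z ↔ inBox n o Ms z' := by
  unfold inBox
  rw [rBlkWt_ne_zero hz, rBlkWt_ne_zero hz']

/-- two sites of the same unit block are both in or both out of `S_j`. [cite: Balaban1983RegularityDecay, (1.1) p.572] -/
theorem inBox_iff_of_blk_eq (o : Fin (d + 1) → ℤ) (Ms : Fin (d + 1) → ℕ) {z z' : ↥(fineDom n Ωc)}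
    (h : blk n z.1 = blk n z'.1) : inBox n o Ms z ↔ inBox n o Ms z' := by
  unfold inBox
  rw [h]

end Geometry

/-! ## §2. The sub-region inclusion (every cube: `□_j = Ω ∩ □̂_j` is itself a finite union of unit blocks) -/

/-- the underlying lattice points of a contour of region points. [folklore] -/
private theorem map_val_pmap_mk {X : Type*} {P : X → Prop} :
    ∀ (l : List X) (H : ∀ z ∈ l, P z), (l.pmap Subtype.mk H).map Subtype.val = l
  | [], _ => rfl
  | a :: l, H => by
      rw [List.pmap, List.map_cons, map_val_pmap_mk l]

/-- the underlying lattice points of [B4]'s staircase contour `Γ_{y,x}` of a region: the staircase from the base corner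
`n·y` when `x ∈ B(y)`, nothing otherwise. [cite: Balaban1983RegularityDecay, (1.4) p.572 «Γ^{(k)}_{y,x}»] -/
theorem map_val_rstairContour {n : ℕ} (hn : 1 ≤ n) (Ω : Finset (Fin (d + 1) → ℤ)) (y : ↥Ω) (x : ↥(fineDom n Ω)) :
    (rstairContour hn Ω y x).map Subtype.val
      = if blk n x.1 = y.1 then stair (fun i => (n : ℤ) * y.1 i) x.1 else [] := by
  unfold rstairContour
  split_ifs with h
  · exact map_val_pmap_mk _ _
  · rfl

section Incl

variable {n : ℕ} {Ωc' Ωc : Finset (Fin (d + 1) → ℤ)}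

/-- the fine region is monotone in the label set. [cite: Balaban1983RegularityDecay, (1.1) p.572] -/
theorem fineDom_mono (hn : 1 ≤ n) (hsub : Ωc' ⊆ Ωc) : fineDom n Ωc' ⊆ fineDom n Ωc := fun _ hx =>
  (mem_fineDom hn).2 (hsub ((mem_fineDom hn).1 hx))

/-- **THE SUB-REGION INCLUSION** of fine sites `□_j = Ω ∩ □̂_j ↪ Ω`. [cite: Balaban1983RegularityDecay, §2 p.575] -/
def incl (hn : 1 ≤ n) (hsub : Ωc' ⊆ Ωc) (x : ↥(fineDom n Ωc')) : ↥(fineDom n Ωc) := ⟨x.1, fineDom_mono hn hsub x.2⟩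

/-- the inclusion of unit labels. [cite: Balaban1983RegularityDecay, (1.1) p.572] -/
def inclY (hsub : Ωc' ⊆ Ωc) (y : ↥Ωc') : ↥Ωc := ⟨y.1, hsub y.2⟩

/-- `incl` is injective. [cite: Balaban1983RegularityDecay, §2 p.575, dictionary] -/
theorem incl_injective (hn : 1 ≤ n) (hsub : Ωc' ⊆ Ωc) : Function.Injective (incl hn hsub) := fun _ _ h =>
  Subtype.ext (congrArg Subtype.val h :)

/-- `inclY` is injective. [cite: Balaban1983RegularityDecay, (1.1) p.572, dictionary] -/
theorem inclY_injective (hsub : Ωc' ⊆ Ωc) : Function.Injective (inclY hsub) := fun _ _ h =>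
  Subtype.ext (congrArg Subtype.val h :)

/-- THE IMAGE: a site of `Ω` lies in the sub-region iff its unit label lies in `Ωc′`. [cite: Balaban1983RegularityDecay, §2 p.575] -/
def inReg (n : ℕ) (Ωc' : Finset (Fin (d + 1) → ℤ)) (x : ↥(fineDom n Ωc)) : Prop := blk n x.1 ∈ Ωc'

/-- membership in the image is decidable. [cite: Balaban1983RegularityDecay, §2 p.575, dictionary] -/
instance inReg.instDecidablePred (n : ℕ) (Ωc' : Finset (Fin (d + 1) → ℤ)) :
    DecidablePred (inReg (Ωc := Ωc) n Ωc') := fun x => by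
  unfold inReg; infer_instance

/-- the image of `incl` is `inReg`. [cite: Balaban1983RegularityDecay, §2 p.575] -/
theorem inReg_iff (hn : 1 ≤ n) (hsub : Ωc' ⊆ Ωc) (x : ↥(fineDom n Ωc)) : inReg n Ωc' x ↔ ∃ a, incl hn hsub a = x :=
  ⟨fun h => ⟨⟨x.1, (mem_fineDom hn).2 h⟩, Subtype.ext rfl⟩,
    by rintro ⟨a, rfl⟩; exact (mem_fineDom hn).1 a.2⟩

/-- **BOND WEIGHTS RESTRICT** (same formula on both carriers). [cite: Balaban1983RegularityDecay, (1.3) p.572] -/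
theorem regWt_incl (hn : 1 ≤ n) (hsub : Ωc' ⊆ Ωc) (a b : ↥(fineDom n Ωc')) :
    regWt n (fineDom n Ωc) (incl hn hsub a) (incl hn hsub b) = regWt n (fineDom n Ωc') a b := rfl

/-- **BLOCK WEIGHTS RESTRICT**. [cite: Balaban1983RegularityDecay, (1.4) p.572] -/
theorem rBlkWt_incl (hn : 1 ≤ n) (hsub : Ωc' ⊆ Ωc) (y' : ↥Ωc') (b : ↥(fineDom n Ωc')) :
    rBlkWt n Ωc (fineDom n Ωc) (inclY hsub y') (incl hn hsub b) = rBlkWt n Ωc' (fineDom n Ωc') y' b := rfl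

/-- **BASE CORNERS RESTRICT**. [cite: Balaban1983RegularityDecay, (1.4) p.572 «Γ^{(k)}_{y,x}»] -/
theorem rbaseEmb_inclY (hn : 1 ≤ n) (hsub : Ωc' ⊆ Ωc) (y' : ↥Ωc') : rbaseEmb hn Ωc (inclY hsub y') = incl hn hsub (rbaseEmb hn Ωc' y') := rfl

/-- **STAIRCASE CONTOURS RESTRICT**: `Γ_{inclY y′, incl b} = incl ∘ Γ_{y′, b}`. [cite: Balaban1983RegularityDecay, (1.4) p.572 «Γ^{(k)}_{y,x}»] -/
theorem rstairContour_incl (hn : 1 ≤ n) (hsub : Ωc' ⊆ Ωc) (y' : ↥Ωc') (b : ↥(fineDom n Ωc')) :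
    rstairContour hn Ωc (inclY hsub y') (incl hn hsub b) = (rstairContour hn Ωc' y' b).map (incl hn hsub) := by
  apply List.map_injective_iff.2 Subtype.val_injective
  have hcomp : (Subtype.val ∘ incl hn hsub) = (Subtype.val : ↥(fineDom n Ωc') → Fin (d + 1) → ℤ) := rfl
  rw [List.map_map, hcomp, map_val_rstairContour, map_val_rstairContour]
  rfl

/-- **TRANSPORTERS RESTRICT**: `U(A(Γ_{inclY y′, incl b})) = U((A∘incl)(Γ_{y′,b}))` for [B4]'s abelian links.
[cite: Balaban1983RegularityDecay, (1.4) p.572 «U(A(Γ^{(k)}_{y,x}))»] -/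
theorem contourTrans_incl (hn : 1 ≤ n) (hsub : Ωc' ⊆ Ωc) {ι : Type} [Fintype ι] [DecidableEq ι] (F : OrthFlow ι)
    (κ : ℝ) (A : ↥(fineDom n Ωc) → ↥(fineDom n Ωc) → ℝ) (y' : ↥Ωc') (b : ↥(fineDom n Ωc')) :
    contourTrans (fieldLink F κ A) (rbaseEmb hn Ωc) (rstairContour hn Ωc) (inclY hsub y') (incl hn hsub b)
      = contourTrans (fieldLink F κ fun a b => A (incl hn hsub a) (incl hn hsub b))
          (rbaseEmb hn Ωc') (rstairContour hn Ωc') y' b := by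
  unfold contourTrans
  rw [transport_fieldLink, transport_fieldLink, rstairContour_incl, rbaseEmb_inclY, lsum_map]

/-- a non-zero block weight `q(y, incl b)` forces `y` to be a label of the sub-region. [cite: Balaban1983RegularityDecay, (1.4) p.572] -/
theorem rBlkWt_incl_ne_zero (hn : 1 ≤ n) (hsub : Ωc' ⊆ Ωc) {y : ↥Ωc} {b : ↥(fineDom n Ωc')}
    (h : rBlkWt n Ωc (fineDom n Ωc) y (incl hn hsub b) ≠ 0) : ∃ y', inclY hsub y' = y := by
  have hb : blk n b.1 = y.1 := rBlkWt_ne_zero h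
  exact ⟨⟨blk n b.1, (mem_fineDom hn).1 b.2⟩, Subtype.ext hb⟩

/-- blocks do not straddle the sub-region. [cite: Balaban1983RegularityDecay, (1.1) p.572] -/
theorem inReg_iff_of_rBlkWt {y : ↥Ωc} {z z' : ↥(fineDom n Ωc)} (hz : rBlkWt n Ωc (fineDom n Ωc) y z ≠ 0)
    (hz' : rBlkWt n Ωc (fineDom n Ωc) y z' ≠ 0) : inReg n Ωc' z ↔ inReg n Ωc' z' := by
  unfold inReg
  rw [rBlkWt_ne_zero hz, rBlkWt_ne_zero hz']

/-- **THE CUBE `□_j = Ω ∩ □̂_j` AS A SUB-REGION**: the image of the inclusion of `fineDom n (Ωc ∩ cubeLabels K j)` is the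
cube's site set `inBox n (cshift K j) 2K`. [cite: Balaban1983RegularityDecay, §2 p.575 «□_j = Ω ∩ {…}»] -/
theorem inReg_inter_cube_iff (hn : 1 ≤ n) (K : ℕ) (j : Fin (d + 1) → ℤ) (x : ↥(fineDom n Ωc)) :
    inReg n (Ωc ∩ cubeLabels K j) x ↔ inBox n (cshift K j) (fun _ => 2 * K) x := by
  rw [inReg, Finset.mem_inter, inBox_cshift_iff]
  exact ⟨fun h => h.2, fun h => ⟨(mem_fineDom hn).1 x.2, h⟩⟩

end Incl

/-! ## §3. The translated box (interior cubes: the carrier of the Lemma-2.2 lineage) -/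

section BoxEmb

variable (ℓ k : ℕ) {Ωc : Finset (Fin (d + 1) → ℤ)} (Ms : Fin (d + 1) → ℕ) (o : Fin (d + 1) → ℤ)

/-- the mesh `n = L^k ≥ 1`. [folklore] -/
private theorem one_le_n : 1 ≤ (ℓ + 1) ^ k := Nat.one_le_pow _ _ (Nat.succ_pos ℓ)

/-- the translate of a site of the box is a site of the region. [cite: Balaban1983RegularityDecay, §2 p.575] -/
theorem shift_mem_fineDom (ho : ∀ y : ↥(boxDom Ms), (y.1 + o) ∈ Ωc) (z : ↥(Box d ℓ k Ms)) :
    (z.1 + fun i => (((ℓ + 1) ^ k : ℕ) : ℤ) * o i) ∈ fineDom ((ℓ + 1) ^ k) Ωc := by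
  rw [mem_fineDom (one_le_n ℓ k), blk_add_mul (one_le_n ℓ k)]
  exact ho ⟨blk ((ℓ + 1) ^ k) z.1, blk_mem_boxDom (one_le_n ℓ k) z.2⟩

/-- **THE TRANSLATED-BOX EMBEDDING** of fine sites: `z ↦ z + n·o` (`n = L^k`, lower corner `o` in unit labels).
[cite: Balaban1983RegularityDecay, §2 p.575 «□_j is a cube of the size 2M and with center in Mj»] -/
def boxEmb (ho : ∀ y : ↥(boxDom Ms), (y.1 + o) ∈ Ωc) (z : ↥(Box d ℓ k Ms)) : ↥(fineDom ((ℓ + 1) ^ k) Ωc) :=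
  ⟨z.1 + fun i => (((ℓ + 1) ^ k : ℕ) : ℤ) * o i, shift_mem_fineDom ℓ k Ms o ho z⟩

/-- the embedding of unit labels: `y ↦ y + o`. [cite: Balaban1983RegularityDecay, (1.1) p.572] -/
def boxEmbY (ho : ∀ y : ↥(boxDom Ms), (y.1 + o) ∈ Ωc) (y : ↥(boxDom Ms)) : ↥Ωc := ⟨y.1 + o, ho y⟩

/-- `boxEmb` is injective. [cite: Balaban1983RegularityDecay, §2 p.575, dictionary] -/
theorem boxEmb_injective (ho : ∀ y : ↥(boxDom Ms), (y.1 + o) ∈ Ωc) : Function.Injective (boxEmb ℓ k Ms o ho) := by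
  intro a b h
  apply Subtype.ext
  have := congrArg Subtype.val h
  simpa [boxEmb] using this

/-- `boxEmbY` is injective. [cite: Balaban1983RegularityDecay, (1.1) p.572, dictionary] -/
theorem boxEmbY_injective (ho : ∀ y : ↥(boxDom Ms), (y.1 + o) ∈ Ωc) : Function.Injective (boxEmbY Ms o ho) := by
  intro a b h
  apply Subtype.ext
  have := congrArg Subtype.val h
  simpa [boxEmbY] using this

/-- the block label of an embedded site is the translated block label. [cite: Balaban1983RegularityDecay, (1.1) p.572] -/
theorem blk_boxEmb (ho : ∀ y : ↥(boxDom Ms), (y.1 + o) ∈ Ωc) (a : ↥(Box d ℓ k Ms)) :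
    blk ((ℓ + 1) ^ k) (boxEmb ℓ k Ms o ho a).1 = blk ((ℓ + 1) ^ k) a.1 + o :=
  blk_add_mul (one_le_n ℓ k) _ _

/-- the image of `boxEmb` is `inBox`. [cite: Balaban1983RegularityDecay, §2 p.575] -/
theorem inBox_iff (ho : ∀ y : ↥(boxDom Ms), (y.1 + o) ∈ Ωc) (x : ↥(fineDom ((ℓ + 1) ^ k) Ωc)) :
    inBox ((ℓ + 1) ^ k) o Ms x ↔ ∃ a, boxEmb ℓ k Ms o ho a = x := by
  have hn := one_le_n ℓ k
  have hn0 : (0 : ℤ) < (((ℓ + 1) ^ k : ℕ) : ℤ) := by exact_mod_cast hn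
  constructor
  · intro hx
    have hmem : (x.1 - fun i => (((ℓ + 1) ^ k : ℕ) : ℤ) * o i) ∈ Box d ℓ k Ms := by
      rw [Box, mem_boxDom]
      intro i
      obtain ⟨h1, h2⟩ := hx i
      have h1' : (((ℓ + 1) ^ k : ℕ) : ℤ) * o i ≤ x.1 i := by
        have := (Int.le_ediv_iff_mul_le hn0).mp h1
        rw [mul_comm] at this
        exact this
      have h2' : x.1 i < (((ℓ + 1) ^ k : ℕ) : ℤ) * (o i + Ms i) := by
        have := (Int.ediv_lt_iff_lt_mul hn0).mp h2
        rw [mul_comm] at this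
        exact this
      rw [mul_add] at h2'
      simp only [Pi.sub_apply]
      push_cast at h1' h2' ⊢
      constructor <;> linarith
    refine ⟨⟨_, hmem⟩, Subtype.ext (funext fun i => ?_)⟩
    simp [boxEmb]
  · rintro ⟨a, rfl⟩ i
    have ha := (mem_boxDom.1 (blk_mem_boxDom hn a.2)) i
    rw [blk_boxEmb]
    simp only [Pi.add_apply]
    constructor <;> linarith [ha.1, ha.2]

/-- **BOND WEIGHTS RESTRICT**: `c(boxEmb a, boxEmb b) = c_□(a, b)` (both are `n²/2` per nearest-neighbour pair).
[cite: Balaban1983RegularityDecay, (1.3) p.572] -/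
theorem regWt_boxEmb (ho : ∀ y : ↥(boxDom Ms), (y.1 + o) ∈ Ωc) (a b : ↥(Box d ℓ k Ms)) :
    regWt ((ℓ + 1) ^ k) (fineDom ((ℓ + 1) ^ k) Ωc) (boxEmb ℓ k Ms o ho a) (boxEmb ℓ k Ms o ho b)
      = boxWt ((ℓ + 1) ^ k) (fun i => (ℓ + 1) ^ k * Ms i) a b := by
  unfold regWt boxWt
  have : ((boxEmb ℓ k Ms o ho b).1 ∈ nbrs (boxEmb ℓ k Ms o ho a).1) ↔ (b.1 ∈ nbrs a.1) :=
    mem_nbrs_add_iff a.1 b.1 _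
  simp only [this]

/-- **BLOCK WEIGHTS RESTRICT**: `q(boxEmbY y′, boxEmb b) = q_□(y′, b)`. [cite: Balaban1983RegularityDecay, (1.4) p.572] -/
theorem rBlkWt_boxEmb (ho : ∀ y : ↥(boxDom Ms), (y.1 + o) ∈ Ωc) (y' : ↥(boxDom Ms)) (b : ↥(Box d ℓ k Ms)) :
    rBlkWt ((ℓ + 1) ^ k) Ωc (fineDom ((ℓ + 1) ^ k) Ωc) (boxEmbY Ms o ho y') (boxEmb ℓ k Ms o ho b)
      = blkWt ((ℓ + 1) ^ k) Ms (fun i => (ℓ + 1) ^ k * Ms i) y' b := by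
  unfold rBlkWt blkWt
  rw [blk_boxEmb]
  have : (blk ((ℓ + 1) ^ k) b.1 + o = (boxEmbY Ms o ho y').1) ↔ (blk ((ℓ + 1) ^ k) b.1 = y'.1) := by
    show (blk ((ℓ + 1) ^ k) b.1 + o = y'.1 + o) ↔ _
    exact ⟨fun h => add_right_cancel h, fun h => by rw [h]⟩
  simp only [this]

/-- **BASE CORNERS RESTRICT**: `n·(y′ + o) = boxEmb(n·y′)`. [cite: Balaban1983RegularityDecay, (1.4) p.572 «Γ^{(k)}_{y,x} … initial point y»] -/
theorem rbaseEmb_boxEmbY (ho : ∀ y : ↥(boxDom Ms), (y.1 + o) ∈ Ωc) (y' : ↥(boxDom Ms)) :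
    rbaseEmb (one_le_n ℓ k) Ωc (boxEmbY Ms o ho y') = boxEmb ℓ k Ms o ho (baseEmb (one_le_n ℓ k) Ms y') := by
  apply Subtype.ext
  funext i
  simp only [rbaseEmb, baseEmb, boxEmb, boxEmbY, Pi.add_apply]
  ring

/-- **STAIRCASE CONTOURS RESTRICT**: `Γ_{boxEmbY y′, boxEmb b} = boxEmb ∘ Γ^□_{y′, b}` — the region's staircase from the
base corner of the translated block is the translate of the box's staircase (`B4Prop31Holonomy.stair_add`).
[cite: Balaban1983RegularityDecay, (1.4) p.572 «Γ^{(k)}_{y,x}»] -/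
theorem rstairContour_boxEmb (ho : ∀ y : ↥(boxDom Ms), (y.1 + o) ∈ Ωc) (y' : ↥(boxDom Ms)) (b : ↥(Box d ℓ k Ms)) :
    rstairContour (one_le_n ℓ k) Ωc (boxEmbY Ms o ho y') (boxEmb ℓ k Ms o ho b)
      = (stairContour (one_le_n ℓ k) Ms y' b).map (boxEmb ℓ k Ms o ho) := by
  apply List.map_injective_iff.2 Subtype.val_injective
  have hcomp : (Subtype.val ∘ boxEmb ℓ k Ms o ho)
      = (fun z : Fin (d + 1) → ℤ => z + fun i => (((ℓ + 1) ^ k : ℕ) : ℤ) * o i) ∘ Subtype.val := by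
    funext z
    rfl
  rw [List.map_map, hcomp, ← List.map_map, map_val_rstairContour, map_val_stairContour]
  by_cases hb : blk ((ℓ + 1) ^ k) b.1 = y'.1
  · have hb' : blk ((ℓ + 1) ^ k) (boxEmb ℓ k Ms o ho b).1 = (boxEmbY Ms o ho y').1 := by
      rw [blk_boxEmb, hb]; rfl
    rw [if_pos hb', if_pos hb, ← stair_add]
    congr 1
    funext i
    simp [boxEmbY, mul_add]
  · have hb' : ¬ blk ((ℓ + 1) ^ k) (boxEmb ℓ k Ms o ho b).1 = (boxEmbY Ms o ho y').1 := by
      intro h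
      apply hb
      rw [blk_boxEmb] at h
      exact add_right_cancel (h.trans rfl)
    rw [if_neg hb', if_neg hb]
    rfl

/-- **TRANSPORTERS RESTRICT**: `U(A(Γ_{boxEmbY y′, boxEmb b})) = U((A∘boxEmb)(Γ^□_{y′,b}))` for [B4]'s abelian links.
[cite: Balaban1983RegularityDecay, (1.4) p.572 «U(A(Γ^{(k)}_{y,x}))»] -/
theorem contourTrans_boxEmb (ho : ∀ y : ↥(boxDom Ms), (y.1 + o) ∈ Ωc) {ι : Type} [Fintype ι] [DecidableEq ι] (F : OrthFlow ι)
    (κ : ℝ) (A : ↥(fineDom ((ℓ + 1) ^ k) Ωc) → ↥(fineDom ((ℓ + 1) ^ k) Ωc) → ℝ) (y' : ↥(boxDom Ms)) (b : ↥(Box d ℓ k Ms)) :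
    contourTrans (fieldLink F κ A) (rbaseEmb (one_le_n ℓ k) Ωc) (rstairContour (one_le_n ℓ k) Ωc)
        (boxEmbY Ms o ho y') (boxEmb ℓ k Ms o ho b)
      = contourTrans (fieldLink F κ fun a b => A (boxEmb ℓ k Ms o ho a) (boxEmb ℓ k Ms o ho b))
          (baseEmb (one_le_n ℓ k) Ms) (stairContour (one_le_n ℓ k) Ms) y' b := by
  unfold contourTrans
  rw [transport_fieldLink, transport_fieldLink, rstairContour_boxEmb, rbaseEmb_boxEmbY, lsum_map]

/-- a non-zero block weight `q(y, boxEmb b)` forces `y` to be a translated label of the box.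
[cite: Balaban1983RegularityDecay, (1.4) p.572] -/
theorem rBlkWt_boxEmb_ne_zero (ho : ∀ y : ↥(boxDom Ms), (y.1 + o) ∈ Ωc) {y : ↥Ωc} {b : ↥(Box d ℓ k Ms)}
    (h : rBlkWt ((ℓ + 1) ^ k) Ωc (fineDom ((ℓ + 1) ^ k) Ωc) y (boxEmb ℓ k Ms o ho b) ≠ 0) :
    ∃ y', boxEmbY Ms o ho y' = y := by
  have hb := rBlkWt_ne_zero h
  rw [blk_boxEmb] at hb
  refine ⟨⟨blk ((ℓ + 1) ^ k) b.1, blk_mem_boxDom (one_le_n ℓ k) b.2⟩, Subtype.ext ?_⟩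
  rw [← hb]
  rfl

end BoxEmb

/-! ## §4. Fields and partition functions along the translation -/

section Fields

/-- **A COMPONENT FIELD TRANSLATES**: `A(x + t, x′ + t) = A^{(t)}(x, x′)` with `A^{(t)}_ν(y) = A_ν(y + t)`.
[cite: Balaban1983RegularityDecay, p.572 «A_{⟨x,x+ηe_μ⟩} = A_μ(x)»] -/
theorem compField_add (Ac : (Fin (d + 1) → ℤ) → Fin (d + 1) → ℝ) (x x' t : Fin (d + 1) → ℤ) :
    compField Ac (x + t) (x' + t) = compField (fun y => Ac (y + t)) x x' := by
  unfold compField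
  have h1 : ∀ ν, (x' + t = x + t + e1 ν) ↔ (x' = x + e1 ν) := fun ν =>
    ⟨fun h => add_right_cancel (h.trans (add_right_comm x t (e1 ν))),
      fun h => by rw [h, add_right_comm]⟩
  have h2 : ∀ ν, (x + t = x' + t + e1 ν) ↔ (x = x' + e1 ν) := fun ν =>
    ⟨fun h => add_right_cancel (h.trans (add_right_comm x' t (e1 ν))),
      fun h => by rw [h, add_right_comm]⟩
  simp only [h1, h2]

/-- a constant configuration is translation invariant. [cite: Balaban1983RegularityDecay, p.581 «constant configurations A₀»] -/
theorem constBond_add {X X' : Type*} (A₀ : Fin (d + 1) → ℝ) (pos : X → Fin (d + 1) → ℤ)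
    (pos' : X' → Fin (d + 1) → ℤ) (t : Fin (d + 1) → ℤ) (e : X' → X) (he : ∀ a, pos (e a) = pos' a + t)
    (a b : X') : constBond A₀ pos (e a) (e b) = constBond A₀ pos' a b := by
  unfold constBond
  refine Finset.sum_congr rfl fun μ _ => ?_
  rw [he a, he b]
  simp only [Pi.add_apply]
  push_cast
  ring

/-- **`θ_j` TRANSLATES TO `θ_{j′}`**: `θ_j(x + n·o) = θ_{j′}(x)` when `o = K(j − j′)`.
[cite: Balaban1983RegularityDecay, §2 p.575 «θ_j(x) = Π_μ θ((x_μ − Mj_μ)/M)»] -/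
theorem thetaZ_add {n K : ℕ} (hn : 1 ≤ n) (hK : 1 ≤ K) {j j' o : Fin (d + 1) → ℤ}
    (ho : ∀ i, o i = (K : ℤ) * (j i - j' i)) (x : Fin (d + 1) → ℤ) :
    thetaZ n K j (x + fun i => (n : ℤ) * o i) = thetaZ n K j' x := by
  have hnr : (n : ℝ) ≠ 0 := Nat.cast_ne_zero.mpr (by omega)
  have hKr : (K : ℝ) ≠ 0 := Nat.cast_ne_zero.mpr (by omega)
  unfold thetaZ thetaCube
  refine Finset.prod_congr rfl fun μ _ => ?_
  congr 1
  simp only [Pi.add_apply, ho μ]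
  push_cast
  field_simp
  ring

/-- **`h_j` TRANSLATES TO `h_{j′}`**: `h_j(x + n·o) = h_{j′}(x)` when `o = K(j − j′)`.
[cite: Balaban1983RegularityDecay, §2 p.575 «h_j(x) = h((x − Mj)/M)»] -/
theorem hZ_add {n K : ℕ} (hn : 1 ≤ n) (hK : 1 ≤ K) {j j' o : Fin (d + 1) → ℤ}
    (ho : ∀ i, o i = (K : ℤ) * (j i - j' i)) (x : Fin (d + 1) → ℤ) :
    hZ n K j (x + fun i => (n : ℤ) * o i) = hZ n K j' x := by
  have hnr : (n : ℝ) ≠ 0 := Nat.cast_ne_zero.mpr (by omega)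
  have hKr : (K : ℝ) ≠ 0 := Nat.cast_ne_zero.mpr (by omega)
  unfold hZ hCube
  refine Finset.prod_congr rfl fun μ _ => ?_
  congr 1
  simp only [Pi.add_apply, ho μ]
  push_cast
  field_simp
  ring

/-- **THE WALK ROUTE's `h_j` AT `M = nK` IS [B4]'s `hZ`**: `hCube (nK) j (x) = hZ n K j x` (integer positions; `x/(nK) =
(x/n)/K`). [cite: Balaban1983RegularityDecay, (2.5) p.576] -/
theorem hCube_rpos_eq_hZ (n K : ℕ) {Ωc : Finset (Fin (d + 1) → ℤ)} (j : Fin (d + 1) → ℤ)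
    (x : ↥(fineDom n Ωc)) : hCube ((n : ℝ) * K) j (rpos n Ωc x) = hZ n K j x.1 := by
  unfold hZ hCube rpos
  refine Finset.prod_congr rfl fun μ _ => ?_
  rw [div_div]

variable (ℓ k : ℕ) {Ωc : Finset (Fin (d + 1) → ℤ)} (Ms : Fin (d + 1) → ℕ) (o : Fin (d + 1) → ℤ)

/-- the restriction of `h_j` along the translated box is the lineage's `hBox … j′`. [cite: Balaban1983RegularityDecay, (2.5) p.576] -/
theorem hZ_boxEmb (ho : ∀ y : ↥(boxDom Ms), (y.1 + o) ∈ Ωc) {K : ℕ} (hK : 1 ≤ K) {j j' : Fin (d + 1) → ℤ} (hoj : ∀ i, o i = (K : ℤ) * (j i - j' i))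
    (b : ↥(Box d ℓ k Ms)) :
    hZ ((ℓ + 1) ^ k) K j (boxEmb ℓ k Ms o ho b).1 = hBox ((ℓ + 1) ^ k) K Ms j' b := by
  have hn : 1 ≤ (ℓ + 1) ^ k := Nat.one_le_pow _ _ (Nat.succ_pos ℓ)
  show hZ ((ℓ + 1) ^ k) K j (b.1 + fun i => (((ℓ + 1) ^ k : ℕ) : ℤ) * o i) = hZ ((ℓ + 1) ^ k) K j' b.1
  exact hZ_add hn hK hoj b.1

/-- **p35's `Ã_j = A₀ + θ_jA′` RESTRICTS ALONG THE TRANSLATED BOX TO THE CUBE CONFIGURATION `Ã_{j′}` OF THE TRANSLATED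
COMPONENT FIELD** (`o = K(j − j′)`; for the cube of the walk route `j′ = 1`, `Ms = 2K`):
`Ã_j(boxEmb a, boxEmb b) = cubeField □ n K j′ A₀ A^{(n·o)} a b`. [cite: Balaban1983RegularityDecay, §2 p.575 «Ã_j = A₀ + θ_jA′»] -/
theorem cubeField_boxEmb (ho : ∀ y : ↥(boxDom Ms), (y.1 + o) ∈ Ωc) {K : ℕ} (hK : 1 ≤ K) {j j' : Fin (d + 1) → ℤ} (hoj : ∀ i, o i = (K : ℤ) * (j i - j' i))
    (A₀ : Fin (d + 1) → ℝ) (Ac : (Fin (d + 1) → ℤ) → Fin (d + 1) → ℝ) (a b : ↥(Box d ℓ k Ms)) :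
    cubeField (fineDom ((ℓ + 1) ^ k) Ωc) ((ℓ + 1) ^ k) K j A₀ Ac (boxEmb ℓ k Ms o ho a) (boxEmb ℓ k Ms o ho b)
      = cubeField (Box d ℓ k Ms) ((ℓ + 1) ^ k) K j' A₀
          (fun y => Ac (y + fun i => (((ℓ + 1) ^ k : ℕ) : ℤ) * o i)) a b := by
  have hn : 1 ≤ (ℓ + 1) ^ k := Nat.one_le_pow _ _ (Nat.succ_pos ℓ)
  have hc : constBond A₀ Subtype.val (boxEmb ℓ k Ms o ho a) (boxEmb ℓ k Ms o ho b)
      = constBond A₀ Subtype.val a b :=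
    constBond_add A₀ Subtype.val Subtype.val (fun i => (((ℓ + 1) ^ k : ℕ) : ℤ) * o i) (boxEmb ℓ k Ms o ho)
      (fun _ => rfl) a b
  have hinf : (boxEmb ℓ k Ms o ho a).1 ⊓ (boxEmb ℓ k Ms o ho b).1
      = (a.1 ⊓ b.1) + fun i => (((ℓ + 1) ^ k : ℕ) : ℤ) * o i := by
    funext i
    show min (a.1 i + _) (b.1 i + _) = min (a.1 i) (b.1 i) + _
    exact (min_add_add_right _ _ _)
  have hcf : compField Ac (boxEmb ℓ k Ms o ho a).1 (boxEmb ℓ k Ms o ho b).1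
      = compField (fun y => Ac (y + fun i => (((ℓ + 1) ^ k : ℕ) : ℤ) * o i)) a.1 b.1 :=
    compField_add Ac a.1 b.1 _
  simp only [cubeField, Pi.add_apply, cubeFluct, fluct, hc, hinf, hcf, thetaZ_add hn hK hoj]

end Fields

end

end Literature.MathematicalPhysics.QuantumFieldTheory.Balaban1983to89.B4RegionCubeCarrier
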